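import Summits.NavierStokesRegularity.NavierStokesRegularity.Theorems.ExtremiserTransienceNearExtremalTransienceExtremiserLiouvilleConstantSpeedTailTools
import HarnessLib

/-!
# Crux `ExtremiserTransience.NearExtremalTransience` (stmt-NavierStokesRegularity-21883), line `extremiser_liouville`,
# stub K1b — THE RADIAL TAIL LAW: `W·∫_{‖x‖≥2R}‖ω‖² + Z·∫_{‖x‖≥2R}|Dω|²_F = O(R^{-1/2})` for every residue jet

`--supports stmt-NavierStokesRegularity-21883` (helper).  Author: prover seat `ns-el-k1b` (g7).  The far-field Caccioppoli
inequality (`…CrossTermsAssembly.farCaccioppoli_weighted`) tested with the radial annular cut-off `(1 − χ_R)χ_{R′}`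
(`…ConstantSpeedTailCutoff`), the generic Leray corrector (`…LerayCorrector.lerayCorrector_bounds`, radius `1`:
`η ≤ 4MK/R + √(∫(Dθ V)²/4π) = O(R^{-1/2})`) and the weighted energies of the cut-off on the jet (`…ConstantSpeedTailTools`):

* `weightIntegrals_le` — the weight integrals of the far-field Caccioppoli inequality against global quantities;
* `tailLaw_jet_cutoff` — the weighted form: `W∫θ‖ω‖² + Z∫θ|Dω|²_F ≤ C/√R` for `θ = (1 − χ_R)χ_{R′}`, all `R′ ≥ 4R`;
* `tailLaw_jet` — **for the constant-speed axial residue JET there are `C ≥ 0`, `R₀ ≥ 1` such that for every `R ≥ R₀` and every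
  bounded measurable `S ⊆ {2R ≤ ‖x‖}`: `W·∫_S‖ω‖² + Z·∫_S|Dω|²_F ≤ C/√R`;**
* `tailLaw_jet_exterior` — the same on the whole exterior region `{2R ≤ ‖x‖}` (monotone convergence).
A first quantitative decay law of the residue at the `|x|`-scale (item (N15′) of the record; radial cut-offs have a LINEAR
defect, whence `R^{-1/2}` and not the `O(1/R)` slab rate).  K1b is NOT proved; nothing here proves NS regularity. [folklore]
-/

noncomputable section

open Set Filter Topology MeasureTheory Metric Function Real Bornology
open scoped ENNReal NNReal Topology InnerProductSpace RealInnerProductSpace ContDiff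

namespace Summit.NavierStokesRegularity.NavierStokesRegularity.Theorems

-- the problem directory repeats the summit name (`NavierStokesRegularity/NavierStokesRegularity`)
set_option linter.dupNamespace false

namespace ExtremiserLiouville

open Literature.Analysis.FluidPDE Literature.Analysis
open DepletionLadder.KStar DepletionLadder.KStar.HalfSpace

variable {v : E3 → E3} {c : E3}

/-- **The weight integrals of the far-field Caccioppoli inequality** for a cut-off with `‖Dθ‖ ≤ 2K/R`,
`‖D∇θ‖ ≤ 2K/R²` (`R ≥ 1`), against the global quantities `Z = Zen v`, `W = Wpa v`, `D = ∫‖Dv‖²` and a given bound `A`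
for `∫‖D∇θ‖‖v − c‖²`. [folklore] -/
theorem weightIntegrals_le (hv : ContDiff ℝ ∞ v)
    (h1 : ∫⁻ x, ‖iteratedFDeriv ℝ 1 v x‖ₑ ^ 2 < ⊤) (h2 : ∫⁻ x, ‖iteratedFDeriv ℝ 2 v x‖ₑ ^ 2 < ⊤)
    {θ : E3 → ℝ} (hθ : ContDiff ℝ ∞ θ) (hθc : HasCompactSupport θ)
    {K R A : ℝ} (hK0 : 0 < K) (hR1 : 1 ≤ R)
    (hDθ : ∀ x, ‖fderiv ℝ θ x‖ ≤ 2 * K / R) (hD2θ : ∀ x, ‖fderiv ℝ (gradient θ) x‖ ≤ 2 * K / R ^ 2)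
    (hT3 : (∫ x, ‖fderiv ℝ (gradient θ) x‖ * ‖v x - c‖ ^ 2) ≤ A) :
    (∫ x, ‖fderiv ℝ θ x‖ * ‖curl v x‖ ^ 2) ≤ 2 * K / R * Zen v ∧
    (∫ x, ‖fderiv ℝ θ x‖ * (‖fderiv ℝ v x‖ ^ 2 + 2 * ‖curl v x‖ ^ 2)) ≤
        2 * K / R * ((∫ x, ‖fderiv ℝ v x‖ ^ 2) + 2 * Zen v) ∧
    (∫ x, (‖fderiv ℝ θ x‖ * (2 * frobeniusNormSq (fderiv ℝ (curl v) x) + ‖curl v x‖ ^ 2 + ‖fderiv ℝ v x‖ ^ 2) +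
      ‖fderiv ℝ (gradient θ) x‖ * (frobeniusNormSq (fderiv ℝ (curl v) x) + ‖v x - c‖ ^ 2))) ≤
      2 * K / R * (3 * Wpa v + Zen v + ∫ x, ‖fderiv ℝ v x‖ ^ 2) + A := by
  have hR0 : 0 < R := one_pos.trans_le hR1
  have hZdef : Zen v = ∫ x, ‖curl v x‖ ^ 2 := rfl
  have hWdef : Wpa v = ∫ x, frobeniusNormSq (fderiv ℝ (curl v) x) := rfl
  have hW0 : 0 ≤ Wpa v := integral_nonneg fun x => frobeniusNormSq_nonneg _
  have iZ : Integrable (fun x => ‖curl v x‖ ^ 2) volume := (integrable_norm_curl_sq (hv.of_le (by norm_cast)) h1).1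
  have iW : Integrable (fun x => frobeniusNormSq (fderiv ℝ (curl v) x)) volume :=
    (integrable_frobeniusNormSq_fderiv_curl (hv.of_le (by norm_cast)) h2).1
  have iD : Integrable (fun x => ‖fderiv ℝ v x‖ ^ 2) volume := by
    have h1' : ∫⁻ x, ‖fderiv ℝ v x‖ₑ ^ 2 < ⊤ := by
      refine lt_of_le_of_lt (le_of_eq (lintegral_congr fun x => ?_)) h1
      rw [← ofReal_norm, ← ofReal_norm, norm_iteratedFDeriv_one]
    exact integrable_sq_norm_of_lintegral_lt_top (hv.continuous_fderiv (by simp)) h1'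
  set D : ℝ := ∫ x, ‖fderiv ℝ v x‖ ^ 2 with hDdef
  have cV : Continuous (fun y => v y - c) := (hv.sub contDiff_const).continuous
  have cω : Continuous (curl v) := (contDiff_curl_top hv).continuous
  have cDv : Continuous (fderiv ℝ v) := hv.continuous_fderiv (by simp)
  have cF : Continuous (fun x => frobeniusNormSq (fderiv ℝ (curl v) x)) :=
    continuous_frobeniusNormSq_fderiv ((contDiff_curl_top hv).of_le (by norm_cast)) one_ne_zero
  have cDθ : Continuous (fderiv ℝ θ) := hθ.continuous_fderiv (by simp)
  have cDg : Continuous (fderiv ℝ (gradient θ)) := (contDiff_gradient_top hθ).continuous_fderiv (by simp)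
  have hDθc : HasCompactSupport (fderiv ℝ θ) := hθc.fderiv (𝕜 := ℝ)
  have hDgc : HasCompactSupport (fderiv ℝ (gradient θ)) := (hasCompactSupport_gradient hθc).fderiv (𝕜 := ℝ)
  refine ⟨?_, ?_, ?_⟩
  · rw [hZdef, ← integral_const_mul]
    exact integral_mono ((cDθ.norm.mul (cω.norm.pow 2)).integrable_of_hasCompactSupport hDθc.norm.mul_right)
      (iZ.const_mul _) fun x => mul_le_mul_of_nonneg_right (hDθ x) (sq_nonneg _)
  · have i12 : Integrable (fun x => ‖fderiv ℝ v x‖ ^ 2 + 2 * ‖curl v x‖ ^ 2) volume := iD.add (iZ.const_mul 2)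
    have e : 2 * K / R * (D + 2 * Zen v) = ∫ x, 2 * K / R * (‖fderiv ℝ v x‖ ^ 2 + 2 * ‖curl v x‖ ^ 2) := by
      rw [integral_const_mul, integral_add iD (iZ.const_mul 2), integral_const_mul, hZdef]
    rw [e]
    exact integral_mono ((cDθ.norm.mul ((cDv.norm.pow 2).add (continuous_const.mul (cω.norm.pow 2)))).integrable_of_hasCompactSupport
      hDθc.norm.mul_right) (i12.const_mul _) fun x => mul_le_mul_of_nonneg_right (hDθ x)
      (add_nonneg (sq_nonneg _) (mul_nonneg zero_le_two (sq_nonneg _)))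
  · have i4a : Integrable (fun x => ‖fderiv ℝ θ x‖ * (2 * frobeniusNormSq (fderiv ℝ (curl v) x) + ‖curl v x‖ ^ 2 +
        ‖fderiv ℝ v x‖ ^ 2)) volume :=
      (cDθ.norm.mul (((continuous_const.mul cF).add (cω.norm.pow 2)).add (cDv.norm.pow 2))).integrable_of_hasCompactSupport
        hDθc.norm.mul_right
    have i4b : Integrable (fun x => ‖fderiv ℝ (gradient θ) x‖ * frobeniusNormSq (fderiv ℝ (curl v) x)) volume :=
      (cDg.norm.mul cF).integrable_of_hasCompactSupport hDgc.norm.mul_right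
    have i4c : Integrable (fun x => ‖fderiv ℝ (gradient θ) x‖ * ‖v x - c‖ ^ 2) volume :=
      (cDg.norm.mul (cV.norm.pow 2)).integrable_of_hasCompactSupport hDgc.norm.mul_right
    have i4bc : Integrable (fun x => ‖fderiv ℝ (gradient θ) x‖ * frobeniusNormSq (fderiv ℝ (curl v) x) +
        ‖fderiv ℝ (gradient θ) x‖ * ‖v x - c‖ ^ 2) volume := i4b.add i4c
    have e : (∫ x, (‖fderiv ℝ θ x‖ * (2 * frobeniusNormSq (fderiv ℝ (curl v) x) + ‖curl v x‖ ^ 2 + ‖fderiv ℝ v x‖ ^ 2) +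
        ‖fderiv ℝ (gradient θ) x‖ * (frobeniusNormSq (fderiv ℝ (curl v) x) + ‖v x - c‖ ^ 2))) =
        (∫ x, ‖fderiv ℝ θ x‖ * (2 * frobeniusNormSq (fderiv ℝ (curl v) x) + ‖curl v x‖ ^ 2 + ‖fderiv ℝ v x‖ ^ 2)) +
          ((∫ x, ‖fderiv ℝ (gradient θ) x‖ * frobeniusNormSq (fderiv ℝ (curl v) x)) +
            ∫ x, ‖fderiv ℝ (gradient θ) x‖ * ‖v x - c‖ ^ 2) := by
      rw [← integral_add i4b i4c, ← integral_add i4a i4bc]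
      exact integral_congr_ae (Eventually.of_forall fun x => by ring)
    have iWZ : Integrable (fun x => 2 * frobeniusNormSq (fderiv ℝ (curl v) x) + ‖curl v x‖ ^ 2) volume :=
      (iW.const_mul 2).add iZ
    have iWZD : Integrable (fun x => 2 * frobeniusNormSq (fderiv ℝ (curl v) x) + ‖curl v x‖ ^ 2 + ‖fderiv ℝ v x‖ ^ 2) volume :=
      iWZ.add iD
    have ha : (∫ x, ‖fderiv ℝ θ x‖ * (2 * frobeniusNormSq (fderiv ℝ (curl v) x) + ‖curl v x‖ ^ 2 + ‖fderiv ℝ v x‖ ^ 2)) ≤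
        2 * K / R * (2 * Wpa v + Zen v + D) := by
      have e2 : 2 * K / R * (2 * Wpa v + Zen v + D) =
          ∫ x, 2 * K / R * (2 * frobeniusNormSq (fderiv ℝ (curl v) x) + ‖curl v x‖ ^ 2 + ‖fderiv ℝ v x‖ ^ 2) := by
        rw [integral_const_mul, integral_add iWZ iD, integral_add (iW.const_mul 2) iZ, integral_const_mul, hZdef, hWdef]
      rw [e2]
      exact integral_mono i4a (iWZD.const_mul _) fun x => mul_le_mul_of_nonneg_right (hDθ x)
        (add_nonneg (add_nonneg (mul_nonneg zero_le_two (frobeniusNormSq_nonneg _)) (sq_nonneg _)) (sq_nonneg _))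
    have hb : (∫ x, ‖fderiv ℝ (gradient θ) x‖ * frobeniusNormSq (fderiv ℝ (curl v) x)) ≤ 2 * K / R ^ 2 * Wpa v := by
      rw [hWdef, ← integral_const_mul]
      exact integral_mono i4b (iW.const_mul _) fun x => mul_le_mul_of_nonneg_right (hD2θ x) (frobeniusNormSq_nonneg _)
    have hb' : 2 * K / R ^ 2 * Wpa v ≤ 2 * K / R * Wpa v := by
      refine mul_le_mul_of_nonneg_right ?_ hW0
      have hRR : R ≤ R ^ 2 := by
        rw [sq]; have := mul_le_mul_of_nonneg_left hR1 hR0.le; linarith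
      exact div_le_div_of_nonneg_left (by positivity) hR0 hRR
    rw [e]
    have : 2 * K / R * (3 * Wpa v + Zen v + D) + A = 2 * K / R * (2 * Wpa v + Zen v + D) + 2 * K / R * Wpa v + A := by
      ring
    rw [this]
    linarith [ha, hb, hb', hT3]

set_option maxHeartbeats 400000 in
/-- **The weighted radial tail law.**  For the residue jet, far field `‖v − c‖ ≤ κ⋆M/3` off `B_{r₀}`: there is `C ≥ 0` with
`W∫θ‖ω‖² + Z∫θ|Dω|²_F ≤ C/√R` for `θ = (1 − χ_R)χ_{R′}`, all `R ≥ max(1,r₀)`, `R′ ≥ 4R`. [folklore] -/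
theorem tailLaw_jet_cutoff
    (hv : ContDiff ℝ ∞ v) (hdiv : VectorCalculus.IsDivFree v) {M B : ℝ} (hMpos : 0 < M)
    (hM : ∀ x, ‖v x‖ = M) (hcM : ‖c‖ = M) (hB : ∀ x, ‖fderiv ℝ v x‖ ≤ B)
    (h1 : ∫⁻ x, ‖iteratedFDeriv ℝ 1 v x‖ₑ ^ 2 < ⊤) (h2 : ∫⁻ x, ‖iteratedFDeriv ℝ 2 v x‖ₑ ^ 2 < ⊤)
    (hpos : 0 < M * Real.sqrt (Zen v) * Real.sqrt (Wpa v))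
    (hatt : |Jst v| = kStar * M * Real.sqrt (Zen v) * Real.sqrt (Wpa v))
    (hc0 : c 0 = 0) (hc1 : c 1 = 0) (hc2 : c 2 ≠ 0)
    (hslab : ∀ T : ℝ, 0 < T → Integrable (fun x => {x : E3 | |x 2| ≤ T}.indicator (fun x => ‖v x - c‖ ^ 2) x) volume)
    {E₀ : ℝ} (hE0 : 0 ≤ E₀) (hE : ∀ s : ℝ, (∫ x, deriv Real.smoothTransition (x 2 - s) * ‖v x - c‖ ^ 2) = E₀)
    {r₀ : ℝ} (hr₀ : ∀ x : E3, r₀ ≤ ‖x‖ → ‖v x - c‖ ≤ kStar * M / 3) :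
    ∃ C : ℝ, 0 ≤ C ∧ ∀ R R' : ℝ, max 1 r₀ ≤ R → 4 * R ≤ R' →
      Wpa v * (∫ x, (1 - cutoff R x) * cutoff R' x * ‖curl v x‖ ^ 2) +
        Zen v * (∫ x, (1 - cutoff R x) * cutoff R' x * frobeniusNormSq (fderiv ℝ (curl v) x)) ≤ C / Real.sqrt R := by
  obtain ⟨K, hK0, hK⟩ := exists_radialCutoff_weights
  have hKst : 0 < kStar := kStar_pos
  have hZ0 : 0 ≤ Zen v := integral_nonneg fun x => sq_nonneg _
  have hW0 : 0 ≤ Wpa v := integral_nonneg fun x => frobeniusNormSq_nonneg _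
  set D : ℝ := ∫ x, ‖fderiv ℝ v x‖ ^ 2 with hDdef
  have hD0 : 0 ≤ D := integral_nonneg fun x => sq_nonneg _
  set σ : ℝ := kStar * M / 3 with hσdef
  have hσ0 : 0 ≤ σ := by rw [hσdef]; positivity
  -- constants
  set ηc : ℝ := 4 * M * K + K * Real.sqrt (19 * E₀ / (4 * π)) with hηc
  have hηc0 : 0 ≤ ηc := by rw [hηc]; positivity
  set C₁ : ℝ := 3 * |Jst v| * σ * (2 * K * Zen v) + |Jst v| * σ * (2 * K * (D + 2 * Zen v)) +
    kStar ^ 2 * M ^ 2 * ((5 / 2 : ℝ) * Wpa v * (19 * K * E₀) + (3 / 2 : ℝ) * Zen v * (2 * K * (3 * Wpa v + Zen v + D) + 19 * K * E₀))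
    with hC₁
  have hC₁0 : 0 ≤ C₁ := by rw [hC₁]; positivity
  set C₀ : ℝ := C₁ + (kStar + kStar ^ 2) * M * Zen v * Wpa v * ηc with hC₀
  have hC₀0 : 0 ≤ C₀ := by rw [hC₀]; positivity
  clear_value C₀
  have hKM2 : 0 < kStar ^ 2 * M ^ 2 := by positivity
  refine ⟨2 * C₀ / (kStar ^ 2 * M ^ 2), by positivity, fun R R' hR hRR' => ?_⟩
  have hR1 : 1 ≤ R := (le_max_left _ _).trans hR
  have hR0 : 0 < R := one_pos.trans_le hR1
  have hR'0 : 0 < R' := by linarith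
  have hR'R : R ≤ R' := by linarith
  set θ : E3 → ℝ := fun x : E3 => (1 - cutoff R x) * cutoff R' x with hθdef
  have hθ : ContDiff ℝ ∞ θ := contDiff_radialCutoff R R'
  have hθc : HasCompactSupport θ := hasCompactSupport_radialCutoff R hR'0
  have hθ01 : ∀ x, 0 ≤ θ x ∧ θ x ≤ 1 := radialCutoff_nonneg_le_one R R'
  have hts := tsupport_radialCutoff_subset hR0 R'
  have hσ' : ∀ x ∈ tsupport θ, ‖v x - c‖ ≤ σ := fun x hx => hr₀ x ((le_max_right _ _).trans (hR.trans (hts hx)))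
  have hσK : 3 * σ ≤ kStar * M := by rw [hσdef]; linarith
  have hKx := hK R R' hR1 hRR'
  have hind_le : ∀ x, (closedBall (0 : E3) (2 * R)).indicator (fun _ => (1 : ℝ)) x ≤ 1 ∧
      (ball (0 : E3) R')ᶜ.indicator (fun _ => (1 : ℝ)) x ≤ 1 ∧ 0 ≤ (closedBall (0 : E3) (2 * R)).indicator (fun _ => (1 : ℝ)) x ∧
      0 ≤ (ball (0 : E3) R')ᶜ.indicator (fun _ => (1 : ℝ)) x := fun x =>
    ⟨indicator_le_self' (fun _ _ => zero_le_one) x, indicator_le_self' (fun _ _ => zero_le_one) x,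
      indicator_nonneg (fun _ _ => zero_le_one) x, indicator_nonneg (fun _ _ => zero_le_one) x⟩
  have hK' : K / R' ≤ K / R := div_le_div_of_nonneg_left hK0.le hR0 hR'R
  have hK'2 : K / R' ^ 2 ≤ K / R ^ 2 := div_le_div_of_nonneg_left hK0.le (by positivity) (by nlinarith)
  have hDθ : ∀ x, ‖fderiv ℝ θ x‖ ≤ 2 * K / R := fun x => by
    have h := (hKx x).1; have hi := hind_le x
    calc ‖fderiv ℝ θ x‖ ≤ K / R * 1 + K / R * 1 :=
          h.trans (add_le_add (mul_le_mul_of_nonneg_left hi.1 (by positivity)) (mul_le_mul hK' hi.2.1 hi.2.2.2 (by positivity)))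
      _ = 2 * K / R := by ring
  have hD2θ : ∀ x, ‖fderiv ℝ (gradient θ) x‖ ≤ 2 * K / R ^ 2 := fun x => by
    have h := (hKx x).2; have hi := hind_le x
    calc ‖fderiv ℝ (gradient θ) x‖ ≤ K / R ^ 2 * 1 + K / R ^ 2 * 1 :=
          h.trans (add_le_add (mul_le_mul_of_nonneg_left hi.1 (by positivity)) (mul_le_mul hK'2 hi.2.1 hi.2.2.2 (by positivity)))
      _ = 2 * K / R ^ 2 := by ring
  -- the corrector (generic)
  set G : E3 → E3 := fun y => θ y • (v y - c) with hGdef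
  have hV : ContDiff ℝ ∞ (fun y => v y - c) := hv.sub contDiff_const
  have hG : ContDiff ℝ ∞ G := hθ.smul hV
  have hGc : HasCompactSupport G := hθc.smul_right
  have hV2M : ∀ x, ‖v x - c‖ ≤ 2 * M := fun x => by
    calc ‖v x - c‖ ≤ ‖v x‖ + ‖c‖ := norm_sub_le _ _
      _ = 2 * M := by rw [hM x, hcM]; ring
  have hdivpt : ∀ x, VectorCalculus.divergence G x = fderiv ℝ θ x (v x - c) := by
    intro x
    have hθd : DifferentiableAt ℝ θ x := (hθ.differentiable (by simp)) x
    have hVd : DifferentiableAt ℝ (fun y => v y - c) x := (hV.differentiable (by simp)) x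
    rw [hGdef, divergence_smul_apply hθd hVd, isDivFree_sub_const hdiv c x, mul_zero, zero_add, real_inner_comm, gradient,
      InnerProductSpace.toDual_symm_apply]
  have hdivG : ∀ x, |VectorCalculus.divergence G x| ≤ 2 * K / R * (2 * M) := by
    intro x
    rw [hdivpt x, ← Real.norm_eq_abs]
    exact ((fderiv ℝ θ x).le_opNorm _).trans (mul_le_mul (hDθ x) (hV2M x) (norm_nonneg _) (by positivity))
  obtain ⟨hp, hηgen, ⟨Bp, hBp⟩, hp1, hp2⟩ := lerayCorrector_bounds hG hGc hdivG
  have hudiv : VectorCalculus.IsDivFree (fun x => (1 - θ x) • (v x - c) + gradient (divPotential G) x) := by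
    have e : (fun x => (1 - θ x) • (v x - c) + gradient (divPotential G) x) =
        fun x => (v x - c) + (-1 : ℝ) • classicalLerayProj G x := by
      funext x
      rw [classicalLerayProj_apply]
      simp only [hGdef, sub_smul, one_smul, smul_sub, neg_one_smul]
      abel
    rw [e]
    intro x
    have hVd : Differentiable ℝ (fun y => v y - c) := hV.differentiable (by simp)
    have hPd : Differentiable ℝ (classicalLerayProj G) := (contDiff_classicalLerayProj hG hGc).differentiable (by simp)
    rw [divergence_add_smul hVd hPd, isDivFree_sub_const hdiv c x, isDivFree_classicalLerayProj hG hGc x, mul_zero, add_zero]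
  -- the two weighted energies of the cut-off (tools file)
  obtain ⟨hT3', hdiv2'⟩ := radialCutoff_weighted_energies hv hdiv hM hcM hc0 hc1 hc2 hslab hE0 hE hK0 hR1 hRR' hKx
  have hT3 : (∫ x, ‖fderiv ℝ (gradient θ) x‖ * ‖v x - c‖ ^ 2) ≤ 19 * K * E₀ / R := hT3'
  have hdiv2 : (∫ x, VectorCalculus.divergence G x ^ 2) ≤ 19 * K ^ 2 * E₀ / R := by
    calc (∫ x, VectorCalculus.divergence G x ^ 2) = ∫ x, (fderiv ℝ θ x (v x - c)) ^ 2 :=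
          integral_congr_ae (Eventually.of_forall fun x => by simp only [hdivpt x])
      _ ≤ _ := hdiv2'
  -- the weighted far-field Caccioppoli inequality with the generic corrector at radius 1
  have hη1 : ∀ y, ‖gradient (divPotential G) y‖ ≤ 2 * K / R * (2 * M) * 1 +
      Real.sqrt ((∫ x, VectorCalculus.divergence G x ^ 2) / (4 * π * 1)) := hηgen 1 one_pos
  -- the corrector excess `η ≤ ηc/√R`
  have hsqrtR : 0 < Real.sqrt R := Real.sqrt_pos.2 hR0
  have hsqrtR1 : 1 ≤ Real.sqrt R := by rw [← Real.sqrt_one]; exact Real.sqrt_le_sqrt hR1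
  have hη : ∀ y, ‖gradient (divPotential G) y‖ ≤ ηc / Real.sqrt R := by
    intro y
    have hs : Real.sqrt ((∫ x, VectorCalculus.divergence G x ^ 2) / (4 * π * 1)) ≤ K * Real.sqrt (19 * E₀ / (4 * π)) / Real.sqrt R := by
      rw [mul_one, div_eq_mul_inv (K * _), ← Real.sqrt_inv, ← Real.sqrt_sq hK0.le, ← Real.sqrt_mul (sq_nonneg _),
        ← Real.sqrt_mul (by positivity)]
      refine Real.sqrt_le_sqrt ?_
      rw [div_le_iff₀ (by positivity)]
      calc (∫ x, VectorCalculus.divergence G x ^ 2) ≤ 19 * K ^ 2 * E₀ / R := hdiv2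
        _ = K ^ 2 * (19 * E₀ / (4 * π)) * R⁻¹ * (4 * π) := by field_simp
    have h1R : 2 * K / R * (2 * M) * 1 ≤ 4 * M * K / Real.sqrt R := by
      rw [mul_one, show 2 * K / R * (2 * M) = 4 * M * K / R by ring]
      refine div_le_div_of_nonneg_left (by positivity) hsqrtR ?_
      calc Real.sqrt R ≤ Real.sqrt R * Real.sqrt R := le_mul_of_one_le_right hsqrtR.le hsqrtR1
        _ = R := Real.mul_self_sqrt hR0.le
    calc ‖gradient (divPotential G) y‖ ≤ _ := hη1 y
      _ ≤ 4 * M * K / Real.sqrt R + K * Real.sqrt (19 * E₀ / (4 * π)) / Real.sqrt R := add_le_add h1R hs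
      _ = ηc / Real.sqrt R := by rw [hηc]; ring
  have hmain := farCaccioppoli_weighted hv hdiv hMpos hM hcM hB h1 h2 hpos hatt hθ hθc hθ01 hσ0 hσ' hσK hp hη hBp hp1
    hp2 hudiv
  -- the weight integrals against global quantities
  obtain ⟨hT1, hT2, hT4⟩ := weightIntegrals_le (c := c) hv h1 h2 hθ hθc hK0 hR1 hDθ hD2θ hT3
  rw [← hDdef] at hT2 hT4
  -- assemble
  set X : ℝ := Wpa v * (∫ x, θ x * ‖curl v x‖ ^ 2) + Zen v * (∫ x, θ x * frobeniusNormSq (fderiv ℝ (curl v) x)) with hXdef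
  have hineq : kStar ^ 2 * M ^ 2 * X / 2 ≤ C₀ / Real.sqrt R := by
    have b1 : 3 * |Jst v| * σ * (∫ x, ‖fderiv ℝ θ x‖ * ‖curl v x‖ ^ 2) ≤ 3 * |Jst v| * σ * (2 * K / R * Zen v) :=
      mul_le_mul_of_nonneg_left hT1 (by positivity)
    have b2 : |Jst v| * σ * (∫ x, ‖fderiv ℝ θ x‖ * (‖fderiv ℝ v x‖ ^ 2 + 2 * ‖curl v x‖ ^ 2)) ≤
        |Jst v| * σ * (2 * K / R * (D + 2 * Zen v)) := mul_le_mul_of_nonneg_left hT2 (by positivity)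
    have b3 : kStar ^ 2 * M ^ 2 * ((5 / 2 : ℝ) * Wpa v * (∫ x, ‖fderiv ℝ (gradient θ) x‖ * ‖v x - c‖ ^ 2) +
        (3 / 2 : ℝ) * Zen v * ∫ x, (‖fderiv ℝ θ x‖ * (2 * frobeniusNormSq (fderiv ℝ (curl v) x) + ‖curl v x‖ ^ 2 +
          ‖fderiv ℝ v x‖ ^ 2) + ‖fderiv ℝ (gradient θ) x‖ * (frobeniusNormSq (fderiv ℝ (curl v) x) + ‖v x - c‖ ^ 2))) ≤
        kStar ^ 2 * M ^ 2 * ((5 / 2 : ℝ) * Wpa v * (19 * K * E₀ / R) +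
          (3 / 2 : ℝ) * Zen v * (2 * K / R * (3 * Wpa v + Zen v + D) + 19 * K * E₀ / R)) := by
      refine mul_le_mul_of_nonneg_left (add_le_add ?_ ?_) hKM2.le
      · exact mul_le_mul_of_nonneg_left hT3 (mul_nonneg (by norm_num) hW0)
      · exact mul_le_mul_of_nonneg_left hT4 (mul_nonneg (by norm_num) hZ0)
    -- every `1/R`-term is `≤` the corresponding `1/√R`-term
    have hRle : 1 / R ≤ 1 / Real.sqrt R := by
      refine div_le_div_of_nonneg_left zero_le_one hsqrtR ?_
      calc Real.sqrt R ≤ Real.sqrt R * Real.sqrt R := le_mul_of_one_le_right hsqrtR.le hsqrtR1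
        _ = R := Real.mul_self_sqrt hR0.le
    have e : C₀ / Real.sqrt R = C₁ * (1 / Real.sqrt R) + (kStar + kStar ^ 2) * M * Zen v * Wpa v * (ηc / Real.sqrt R) := by
      rw [hC₀]; ring
    have hpart : C₁ * (1 / R) ≤ C₁ * (1 / Real.sqrt R) := mul_le_mul_of_nonneg_left hRle hC₁0
    have e1 : 3 * |Jst v| * σ * (2 * K / R * Zen v) + |Jst v| * σ * (2 * K / R * (D + 2 * Zen v)) +
        kStar ^ 2 * M ^ 2 * ((5 / 2 : ℝ) * Wpa v * (19 * K * E₀ / R) +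
          (3 / 2 : ℝ) * Zen v * (2 * K / R * (3 * Wpa v + Zen v + D) + 19 * K * E₀ / R)) = C₁ * (1 / R) := by
      rw [hC₁]; ring
    rw [e]
    linarith [hmain, b1, b2, b3, hpart, e1]
  have hX : X ≤ 2 * C₀ / (kStar ^ 2 * M ^ 2) / Real.sqrt R := by
    have h := mul_le_mul_of_nonneg_left hineq (show 0 ≤ 2 / (kStar ^ 2 * M ^ 2) by positivity)
    have e1 : 2 / (kStar ^ 2 * M ^ 2) * (kStar ^ 2 * M ^ 2 * X / 2) = X := by field_simp
    have e2 : 2 / (kStar ^ 2 * M ^ 2) * (C₀ / Real.sqrt R) = 2 * C₀ / (kStar ^ 2 * M ^ 2) / Real.sqrt R := by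
      field_simp
    rw [e1, e2] at h
    exact h
  exact hX

/-- **THE RADIAL TAIL LAW OF THE RESIDUE JET.**  See the module docstring. [folklore] -/
theorem tailLaw_jet
    (hv : ContDiff ℝ ∞ v) (hdiv : VectorCalculus.IsDivFree v) {M B : ℝ} (hMpos : 0 < M)
    (hM : ∀ x, ‖v x‖ = M) (hcM : ‖c‖ = M) (hB : ∀ x, ‖fderiv ℝ v x‖ ≤ B)
    (h1 : ∫⁻ x, ‖iteratedFDeriv ℝ 1 v x‖ₑ ^ 2 < ⊤) (h2 : ∫⁻ x, ‖iteratedFDeriv ℝ 2 v x‖ₑ ^ 2 < ⊤)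
    (hpos : 0 < M * Real.sqrt (Zen v) * Real.sqrt (Wpa v))
    (hatt : |Jst v| = kStar * M * Real.sqrt (Zen v) * Real.sqrt (Wpa v))
    (hc0 : c 0 = 0) (hc1 : c 1 = 0) (hc2 : c 2 ≠ 0)
    (hfar : Tendsto (fun x => v x - c) (cocompact E3) (𝓝 0))
    (hslab : ∀ T : ℝ, 0 < T → Integrable (fun x => {x : E3 | |x 2| ≤ T}.indicator (fun x => ‖v x - c‖ ^ 2) x) volume)
    {E₀ : ℝ} (hE0 : 0 ≤ E₀) (hE : ∀ s : ℝ, (∫ x, deriv Real.smoothTransition (x 2 - s) * ‖v x - c‖ ^ 2) = E₀) :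
    ∃ C : ℝ, 0 ≤ C ∧ ∃ R₀ : ℝ, 1 ≤ R₀ ∧ ∀ R : ℝ, R₀ ≤ R → ∀ S : Set E3, MeasurableSet S → IsBounded S →
      S ⊆ {x : E3 | 2 * R ≤ ‖x‖} →
      Wpa v * (∫ x in S, ‖curl v x‖ ^ 2) + Zen v * (∫ x in S, frobeniusNormSq (fderiv ℝ (curl v) x)) ≤ C / Real.sqrt R := by
  have hKst : 0 < kStar := kStar_pos
  have hZ0 : 0 ≤ Zen v := integral_nonneg fun x => sq_nonneg _
  have hW0 : 0 ≤ Wpa v := integral_nonneg fun x => frobeniusNormSq_nonneg _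
  -- far field
  obtain ⟨r₀, hr₀⟩ : ∃ r₀ : ℝ, ∀ x : E3, r₀ ≤ ‖x‖ → ‖v x - c‖ ≤ kStar * M / 3 := by
    have hδ : 0 < kStar * M / 3 := by positivity
    have h : (fun x => v x - c) ⁻¹' Metric.ball (0 : E3) (kStar * M / 3) ∈ cocompact E3 :=
      hfar (Metric.ball_mem_nhds (0 : E3) hδ)
    rw [mem_cocompact] at h
    obtain ⟨Kc, hKc, hKsub⟩ := h
    obtain ⟨ρ, hρ⟩ := (Metric.isBounded_iff_subset_closedBall (0 : E3)).1 hKc.isBounded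
    refine ⟨ρ + 1, fun x hx => ?_⟩
    have hxK : x ∉ Kc := fun hmem => by
      have := hρ hmem; rw [mem_closedBall, dist_zero_right] at this; linarith
    have := hKsub hxK
    rw [mem_preimage, Metric.mem_ball, dist_zero_right] at this
    exact this.le
  obtain ⟨C, hC0, hC⟩ := tailLaw_jet_cutoff hv hdiv hMpos hM hcM hB h1 h2 hpos hatt hc0 hc1 hc2 hslab hE0 hE hr₀
  refine ⟨C, hC0, max 1 r₀, le_max_left _ _, fun R hR S hS hSb hSsub => ?_⟩
  have hR1 : 1 ≤ R := (le_max_left _ _).trans hR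
  have hR0 : 0 < R := one_pos.trans_le hR1
  obtain ⟨ρ₁, hρ₁⟩ := (Metric.isBounded_iff_subset_closedBall (0 : E3)).1 hSb
  set R' : ℝ := max (4 * R) ρ₁ with hR'def
  have hRR' : 4 * R ≤ R' := le_max_left _ _
  have hR'0 : 0 < R' := by positivity
  set θ : E3 → ℝ := fun x : E3 => (1 - cutoff R x) * cutoff R' x with hθdef
  have hθ : ContDiff ℝ ∞ θ := contDiff_radialCutoff R R'
  have hθc : HasCompactSupport θ := hasCompactSupport_radialCutoff R hR'0
  have hθ0 : ∀ x, 0 ≤ θ x := fun x => (radialCutoff_nonneg_le_one R R' x).1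
  have hkey : Wpa v * (∫ x, θ x * ‖curl v x‖ ^ 2) + Zen v * (∫ x, θ x * frobeniusNormSq (fderiv ℝ (curl v) x)) ≤
      C / Real.sqrt R := hC R R' hR hRR'
  -- `θ = 1` on `S`
  have hθ1 : ∀ x ∈ S, θ x = 1 := by
    intro x hx
    have h2 : 2 * R ≤ ‖x‖ := hSsub hx
    have hxn : ‖x‖ ≤ R' := by
      have := hρ₁ hx; rw [mem_closedBall, dist_zero_right] at this; exact this.trans (le_max_right _ _)
    exact radialCutoff_eq_one hR0 hR'0 h2 hxn
  have cω : Continuous (curl v) := (contDiff_curl_top hv).continuous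
  have cF : Continuous (fun x => frobeniusNormSq (fderiv ℝ (curl v) x)) :=
    continuous_frobeniusNormSq_fderiv ((contDiff_curl_top hv).of_le (by norm_cast)) one_ne_zero
  have hZS := setIntegral_le_integral_mul_of_eq_one (cω.norm.pow 2) (fun x => sq_nonneg _) hθ.continuous hθc hθ0 hS hSb hθ1
  have hWS := setIntegral_le_integral_mul_of_eq_one cF (fun x => frobeniusNormSq_nonneg _) hθ.continuous hθc hθ0 hS hSb hθ1
  calc Wpa v * (∫ x in S, ‖curl v x‖ ^ 2) + Zen v * (∫ x in S, frobeniusNormSq (fderiv ℝ (curl v) x))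
      ≤ Wpa v * (∫ x, θ x * ‖curl v x‖ ^ 2) + Zen v * (∫ x, θ x * frobeniusNormSq (fderiv ℝ (curl v) x)) :=
        add_le_add (mul_le_mul_of_nonneg_left hZS hW0) (mul_le_mul_of_nonneg_left hWS hZ0)
    _ ≤ _ := hkey

/-- **The radial tail law on the whole exterior region** `{2R ≤ ‖x‖}` (monotone convergence from `tailLaw_jet`). [folklore] -/
theorem tailLaw_jet_exterior
    (hv : ContDiff ℝ ∞ v) (hdiv : VectorCalculus.IsDivFree v) {M B : ℝ} (hMpos : 0 < M)
    (hM : ∀ x, ‖v x‖ = M) (hcM : ‖c‖ = M) (hB : ∀ x, ‖fderiv ℝ v x‖ ≤ B)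
    (h1 : ∫⁻ x, ‖iteratedFDeriv ℝ 1 v x‖ₑ ^ 2 < ⊤) (h2 : ∫⁻ x, ‖iteratedFDeriv ℝ 2 v x‖ₑ ^ 2 < ⊤)
    (hpos : 0 < M * Real.sqrt (Zen v) * Real.sqrt (Wpa v))
    (hatt : |Jst v| = kStar * M * Real.sqrt (Zen v) * Real.sqrt (Wpa v))
    (hc0 : c 0 = 0) (hc1 : c 1 = 0) (hc2 : c 2 ≠ 0)
    (hfar : Tendsto (fun x => v x - c) (cocompact E3) (𝓝 0))
    (hslab : ∀ T : ℝ, 0 < T → Integrable (fun x => {x : E3 | |x 2| ≤ T}.indicator (fun x => ‖v x - c‖ ^ 2) x) volume)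
    {E₀ : ℝ} (hE0 : 0 ≤ E₀) (hE : ∀ s : ℝ, (∫ x, deriv Real.smoothTransition (x 2 - s) * ‖v x - c‖ ^ 2) = E₀) :
    ∃ C : ℝ, 0 ≤ C ∧ ∃ R₀ : ℝ, 1 ≤ R₀ ∧ ∀ R : ℝ, R₀ ≤ R →
      Wpa v * (∫ x in {x : E3 | 2 * R ≤ ‖x‖}, ‖curl v x‖ ^ 2) +
        Zen v * (∫ x in {x : E3 | 2 * R ≤ ‖x‖}, frobeniusNormSq (fderiv ℝ (curl v) x)) ≤ C / Real.sqrt R := by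
  obtain ⟨C, hC, R₀, hR₀, h⟩ := tailLaw_jet hv hdiv hMpos hM hcM hB h1 h2 hpos hatt hc0 hc1 hc2 hfar hslab hE0 hE
  refine ⟨C, hC, R₀, hR₀, fun R hR => ?_⟩
  set T : Set E3 := {x : E3 | 2 * R ≤ ‖x‖} with hTdef
  have hT : MeasurableSet T := measurableSet_le measurable_const measurable_norm
  set s : ℕ → Set E3 := fun n => T ∩ ball (0 : E3) (n + 1) with hsdef
  have hsm : ∀ n, MeasurableSet (s n) := fun n => hT.inter measurableSet_ball
  have hmono : Monotone s := fun m n hmn => inter_subset_inter_right _ (ball_subset_ball (by exact_mod_cast Nat.succ_le_succ hmn))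
  have hU : (⋃ n, s n) = T := by
    refine Subset.antisymm (iUnion_subset fun n => inter_subset_left) fun x hx => ?_
    obtain ⟨n, hn⟩ := exists_nat_gt ‖x‖
    exact mem_iUnion.2 ⟨n, hx, by rw [mem_ball, dist_zero_right]; linarith⟩
  have iZ : Integrable (fun x => ‖curl v x‖ ^ 2) volume := (integrable_norm_curl_sq (hv.of_le (by norm_cast)) h1).1
  have iW : Integrable (fun x => frobeniusNormSq (fderiv ℝ (curl v) x)) volume :=
    (integrable_frobeniusNormSq_fderiv_curl (hv.of_le (by norm_cast)) h2).1
  have tZ := tendsto_setIntegral_of_monotone (μ := volume) hsm hmono iZ.integrableOn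
  have tW := tendsto_setIntegral_of_monotone (μ := volume) hsm hmono iW.integrableOn
  rw [hU] at tZ tW
  refine le_of_tendsto' ((tZ.const_mul (Wpa v)).add (tW.const_mul (Zen v))) fun n => ?_
  exact h R hR (s n) (hsm n) (isBounded_ball.subset inter_subset_right) inter_subset_left

end ExtremiserLiouville

end Summit.NavierStokesRegularity.NavierStokesRegularity.Theorems

end
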